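import Summits.QuantumFields.YangMills.Theorems.BalabanUVNodesN12MinimiserFamilyOfClassGaugeRowUniform
import Literature.MathematicalPhysics.QuantumFieldTheory.Balaban1983to89.Node00.MultiScaleFibreChartB
import Literature.MathematicalPhysics.QuantumFieldTheory.Balaban1983to89.B15Prop1GradientFromNearValueB
import Literature.MathematicalPhysics.QuantumFieldTheory.Balaban1983to89.B15Prop1FlatAverageBoundOfGuardOnB
import Literature.MathematicalPhysics.QuantumFieldTheory.Balaban1983to89.B15Prop1FlatCoerciveSplitB
import Literature.MathematicalPhysics.QuantumFieldTheory.Balaban1983to89.B15Prop1TowerFlatOfNearFlatB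
import Summits.QuantumFields.YangMills.Theorems.BalabanUVNodesN12FlatAveragedCoerciveOfForestSU2ChartB
import Summits.QuantumFields.YangMills.Theorems.BalabanUVNodesN12MinimiserFamilyOfClassNearFlatCoerciveB
import Summits.QuantumFields.YangMills.Theorems.BalabanUVNodesN12TowerGuardsOfClassB
import HarnessLib

/-!
# DAG node N12 [B15] — εreg-UNIFORM EDITIONS OF THE (β)-DISCHARGED (J0′) PRODUCERS: the constants `c♭, C, r` are announced BEFORE the class tolerance; every `εreg`-dependent row (the — **BOND-DATUM EDITION** (`…N12MinimiserFamilyOfClassGaugeRowUniformB`, USED DECLARATIONS ONLY)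

The print-datum ([Balaban1984PropagatorsII] (2.3)) (γ) twin of `Summits/…/Theorems/BalabanUVNodesN12MinimiserFamilyOfClassGaugeRowUniform.lean`: the declarations of the parent whose STATEMENT reads the determining datum
(`hMin_atRecord_of_node00Letters_thm1AtBase_central_ofClass_gaugeRow_uniform`, `hMin_atRecord_of_node00Letters_thm1AtBase_central_ofClass_gaugeRows_uniform`) and which N12's junction of record v14ᴸ uses (dag-n12-c g35 probe-2 census `UsedConstsN12RoadTyped2`, THEOREMS block), re-typed over a
BOND-LEVEL datum `𝔅 : BDetSet` (F0a `B15DeterminingSetsB`) and dag-n12-c's bond-datum chart `Node00.msChartB` (✓p774329; `msChart 𝐁 = msChartB (bondsDet 𝐁)` by `rfl`).  GENERATOR twin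
(this seat's `work/g32/gen_thm.py`, block-extracted from the parent's tree bytes): namespace `…N12MinimiserFamilyOfClassGaugeRowUniformB`, SAME short names, `DetSet ↦ BDetSet`, `AgreeOn 𝐁 ↦ AgreeOnB 𝔅`,
`IsMinimizer ↦ IsMinimizerB`, `bondsOf (𝐁 j) ↦ 𝔅 j`, `msChart ∕ constrCard ∕ constrEnum ∕ ConstrSet ↦ …B`, NODE 00 chart lemmas `…msChart… ↦ …msChartB…`; proofs VERBATIM; the parent's
datum-free declarations REUSED BY NAME (`open`), never copied (private plumbing excepted, №366 R2).  The parent's (b) statements are the instances `𝔅 := bondsDet 𝐁`.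
STRUCTURAL RE-KEY AT LEVEL 0 (dag-n12-c `S`-device, as in this seat`s 147 ✓p776610 `…MinimiserFamilyOfClassNearFlatCoerciveB`): the level-0 SUPPORT SET is DISPLAYED — binders `(S₀ : Set (PBond (F.P Kt) 0)) (hS₀ : ∀ b ∉ S₀, b ∈ lamBondsSeq (maxDomT ν.M₁ Z) k 0)` after `hk0`; the (δ) row is asked on the plaquettes meeting `S₀` (parent: a bond SOURCED in `Ω₁(Z)`, reading (b)); the single-row edition `…_gaugeRow_uniform` also displays `hS₀1 : {b | b.src ∈ Ω₁(Z)} ⊆ S₀` and derives (δ_T) from (δ) through dag-n12-c`s bond-datum `B15Prop1TowerFlatOfNearFlatB.towerNearFlat_of_nearFlat_of_agreeOn_constr` (`h𝔅sub` = F0a `lamBondsSeq_subset_bondsOf_genSet`, `h𝔅0` = `B15Prop1GradientFromNearValueB.mem_lamDatumP_maxDomT_zero_of_not_mem₂`). At print`s datum `S₀ := {b | b.src ∈ Ω₁(Z) ∨ b.tgt ∈ Ω₁(Z)}` inhabits both letters. (P♭Q) from this seat`s `…FlatAveragedCoerciveOfForestSU2ChartB` over dag-n12-w6`s ✓`…F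latAveragedCoerciveOfForestLam`.
Cell `pub-ymgap` (HUMAN RULINGS D-0062 ∕ D-0149), seat `pub-ymgap-dag-n12-d` g32 (R134 N12 [B15] s2; the (ii) Theorems-side re-key of N12's road at print's [II] (2.3) datum — director-ym №338 ∕
№343 (E1)(iii-b), FLAG №16 ∕ ruling (α); dag-n12-c DESIGN memo a793b2ebc0b803bf (ii); `N12-ROAD-TWIN-ORDER-2026-08-30.md`).  Count-neutral helper of K1⁹ `stmt-QuantumFields-27364`,
`--kind proof --supports … --as helper`.  THEOREMS ONLY (0 `def`, 0 `instance`, 0 `sorry`).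

HONEST FRAMING (director-ym №338 (5)).  PURELY ADDITIVE: the parent stays landed and true on its own text; nothing in it is edited; no displayed premise of any consumer is deleted or
weakened; every hypothesis of the parent stays a hypothesis.  Nothing of Bałaban's analysis asserted; N12 NOT discharged; K0⁷ ∕ K1⁹ NOT closed; counts unmoved (typed 28∕28 · discharged
8∕27, A 8∕28; K 1∕4); one finite 𝕋⁴ programme at fixed ε — R4 closes the conditional rung `BalabanLadder.UV` only; NOT the Yang–Mills mass gap (Clay); nothing continuum ∕ ℝ⁴ ∕ OS.

PARENT's DOCSTRING (the mathematics and the citations; read the site-level `𝐁` as the bond datum `𝔅`):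
# DAG node N12 [B15] — εreg-UNIFORM EDITIONS OF THE (β)-DISCHARGED (J0′) PRODUCERS: the constants `c♭, C, r` are announced BEFORE the class tolerance; every `εreg`-dependent row (the
# floor, the class facts, class membership of the minimiser, the conclusion's class) is restated at `ν⟨εreg := εr⟩` for a tolerance `εr` chosen AFTER the constants (`M₁` unchanged)

[Balaban1989LargeFieldII] = «[LF-II]», p. 357, (1.7)–(1.9) p. 358, (1.12) p. 359; [Balaban1989LargeFieldI] = «[IV]», (1.74) p. 192, Prop. 1 p. 194; [Balaban1985Variational] = «[15]», Thm 1
p. 279, Sect. C (44)–(48) p. 285, (82)–(83) p. 290, Sect. G pp. 305–307; [Balaban1984PropagatorsII] = «[B6]», Lemma 2.4 (2.128) p. 245; [Balaban1985Averaging] = «[4]», (122)–(126) p. 36;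
[Balaban1985BackgroundPropagators] = «[B9]», (3.79)–(3.81) p. 406; [Balaban1988Convergent] = «[III]», (1.3) p. 246, (2.2) p. 255, (2.10)–(2.13) pp. 256–257.

Cell `pub-ymgap`, HUMAN RULINGS D-0062 ∕ D-0149, lane owner `pub-ymgap-dag-n12-c` (g26, strategy s1).  Key K1⁹ `stmt-QuantumFields-27364`, `--kind proof --supports … --as helper`; count-neutral.
NEW leaf; CONSUMED BY NAME, nothing modified: the lane's (β)-split capstone `…N12MinimiserFamilyOfClassNearFlatCoercive` (g25, p712371 — stated for EVERY `ν`), the (P♭Q) and (L) inhabitants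
`…N12FlatAveragedCoerciveOfForestSU2Chart` ∕ `B15Prop1FlatAverageBoundOfGuardOn` (whose constants do NOT read `εreg`), the split `B15Prop1FlatCoerciveSplit`, the tower guards from the class
`…N12TowerGuardsOfClass`, and `B15Prop1TowerFlatOfNearFlat` ((δ_T) ⟸ (δ)).

WHY (lane self-report «LOCATED-δ₀ν ∕ LOCATED-SHAPE-V5», pub-ymgap INBOX 2026-08-29T14:02Z).  V2 (`…GaugeRows`, p717767) and V3 (`…GaugeRow`, p721526) announce their constants `∃ c♭ C r`
AFTER the record numerics `ν : Stage7Numerics`, hence formally after the class tolerance `ν.εreg`, although the proof builds them from `(Kt, k, Z, ν.M₁, forest, ρ″)` alone.  A consumer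
who must take `εreg` small compared with announced constants (the floors, and downstream the (σ)_N tolerance) needs the other binder order.  THIS FILE restates V2 and V3 with the
constants FIRST and every `εreg`-dependent row under `∀ εr` at `ν⟨εreg := εr⟩ := {ν with εreg := εr}` (`.M₁` unchanged by `rfl`, so `𝐁_k(Z)`, the maximal domains and every geometric object
are literally the same); the proofs are V2's and V3's, replayed with p712371 instantiated at `ν⟨εreg := εr⟩`.

CONTENTS (namespace `Summit.QuantumFields.YangMills.BalabanUVNodes.N12MinimiserFamilyOfClassGaugeRowUniform`; two theorems, no `def`, no `instance`, no `sorry`).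
★★★ `hMin_atRecord_of_node00Letters_thm1AtBase_central_ofClass_gaugeRows_uniform` (V2u: two gauge rows (δ), (δ_T), the multiplier row (M), numerics) · ★★★
`hMin_atRecord_of_node00Letters_thm1AtBase_central_ofClass_gaugeRow_uniform` (V3u: (δ_T) dropped via `B15Prop1TowerFlatOfNearFlat`).

HONEST FRAMING ∕ LOCATED.  Binder re-ordering only; (δ)∕(δ_T) GAUGE letters, (M) the multiplier letter, `c♭, C, r` EXISTENTIAL per (instance, height) but now CERTIFIED independent of the
class tolerance (still U4: NOT print's volume-uniform constants; k-uniformity NOT claimed); nothing of Bałaban's estimates asserted; count-neutral helper; N12 NOT discharged; K1⁹ NOT closed;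
counts unmoved; one finite 𝕋⁴ programme at fixed ε — R4 closes the conditional finite-𝕋⁴ rung `BalabanLadder.UV` only; NOT continuum ∕ OS ∕ mass gap ∕ Clay.
-/

noncomputable section

open scoped BigOperators Matrix.Norms.L2Operator Topology

namespace Summit.QuantumFields.YangMills.BalabanUVNodes.N12MinimiserFamilyOfClassGaugeRowUniformB

open Literature.MathematicalPhysics.QuantumFieldTheory.Balaban1983to89.B15DeterminingSetsB

open Set Metric Filter
open Literature.MathematicalPhysics.QuantumFieldTheory.Balaban1983to89
open Literature.MathematicalPhysics.QuantumFieldTheory.Balaban1983to89.Node00 (SU coeField coeField_apply SmallBelow ConstrSetB constrCardB constrEnumB dIterL)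
open T4Continuum B15DeterminingSets GaugeField
open B14.Eq213MaximalDomains (side)
open B14.Eq213DetSet (Bj Bj_of_gt Bj_zero maxDomT)
open B15Prop1Carrier (plaqsInside)
open B15AveragingHolomorphic (iterMh)
open B15ComplexifiedDatumFamily (conjVec)
open B15SU2ChartHolomorphic (genE expMulC logCoordC)
open B15Prop1AnalyticExtClause (cplxVec norm_cplxVec_apply)
open B15Prop1ChartCalculusSU2 (E3)
open B15Prop1ChartSU2 (su2Chart)
open B15ShellGauge193 (shellGauge)
open B15Extension193 (extend)
open B16Sect1Backgrounds (toMS expMul)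
open ExpMeanLog (expMeanLogSU)
open BlockAveraging (blockAvg)
open T4CubeChartGnomonic (SU2)
open Literature.MathematicalPhysics.QuantumFieldTheory.BalabanImbrieJaffe1984to88.BIJ85Eq453GaugeField (qsstarGIter0)
open B15Prop1FlatCoerciveSplitB (flatCoercive_of_flatAveragedCoercive_of_flatAverageBound_sliceDatum)
open B15Prop1FlatAverageBoundOfGuardOnB (exists_flatAverageBound_of_guardOn_towerNearFlat)
open Summit.QuantumFields.YangMills.BalabanUVNodes.N12TowerGuardsOfClassB (guardOn_towerRegion_lamBondsSeq_of_mem_class)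
open Summit.QuantumFields.YangMills.BalabanUVNodes.N12MinimiserFamilyOfClassNearFlatCoerciveB (hMin_atRecord_of_node00Letters_thm1AtBase_central_ofClass_nearFlat)
open Summit.QuantumFields.YangMills.BalabanUVNodes.N12FlatAveragedCoerciveOfForestSU2ChartB (exists_flatAveragedCoercive_forest_lamBondsSeq_su2Chart)
open scoped Matrix.Norms.L2Operator

open B15Prop1TowerFlatOfNearFlatB (towerNearFlat_of_nearFlat_of_agreeOn_constr)
open B15Prop1GradientFromNearValue (mem_lamDatumP_maxDomT_zero_of_not_mem₂)

section
variable {F : T4Family} {k : ℕ}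

/-- ★★★ **V2u — THE (β)-DISCHARGED (J0′) PRODUCER WITH ITS CONSTANTS ANNOUNCED BEFORE THE CLASS TOLERANCE.**  As `…N12MinimiserFamilyOfClassGaugeRows` (p717767) VERBATIM, except:
the window `Λ lo hi`, the datum tolerance `δ`, the extension `ext`, the compact parameter set `K`, the bound `𝓐₀`, then the binders `0 ≤ ν.εreg`, the floor `6(d−1)L·εreg ≤ ρ″` and the class facts `reg' hreg' hcl hDreg'` ALL move AFTER `∃ c♭ C r` (under `∀`), and every occurrence of the class reads
`regMSCoPOfRecord F 2 {ν with εreg := εr} …`.  Proof = p717767's: `c♭` from `exists_flatAveragedCoercive_forest_lamBondsSeq_su2Chart`, `C, r` from `exists_flatAverageBound_of_guardOn_towerNearFlat`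
(neither reads `εreg`), then p712371 at `ν⟨εreg := εr⟩`.
[cite: Balaban1989LargeFieldII, p.357, (1.7)–(1.9) p.358, (1.12) p.359; Balaban1989LargeFieldI, (1.74) p.192, Prop. 1 p.194; Balaban1985Variational, Thm 1 p.279, Sect. C (44)–(48) p.285, (82)–(83) p.290, Sect. G pp.305–307; Balaban1984PropagatorsII, Lemma 2.4 (2.128) p.245; Balaban1985Averaging, (122)–(126) p.36; Balaban1985BackgroundPropagators, (3.79)–(3.81) p.406; Balaban1988Convergent, (2.2) p.255, (2.10)–(2.13) pp.256–257] -/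
theorem hMin_atRecord_of_node00Letters_thm1AtBase_central_ofClass_gaugeRows_uniform (ν : Node00.Stage7Numerics) (Kt : ℕ) (hd : 2 ≤ (F.P Kt).d) (Z : Set (Site (F.P Kt) 0)) (𝔅 : BDetSet (F.P Kt)) (h𝔅Z : 𝔅 = lamBondsSeq (maxDomT ν.M₁ Z) k) (hkK : k + 1 ≤ (F.P Kt).m + (F.P Kt).K)
    (hM4 : 4 * (F.P Kt).L ≤ ν.M₁) (hdiv : side (F.P Kt).L ν.M₁ k ∣ (F.P Kt).sitesPerDir 0) (hZblk : B14.Eq22Determines.IsBlockUnion k Z)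
    {ρ'' : ℝ} (hsbU : ∀ W : GaugeField (F.P Kt) 0 SU2, ‖coeField W - 1‖ ≤ ρ'' → SmallBelow (Node00.avOfRecord F 2 Kt) k W)
    -- ONCE per height: the numerics of the (β) split — the near-flat tolerance, the flat coercivity constant, the multiplier constant
    (hk0 : 0 < k) (S₀ : Set (PBond (F.P Kt) 0)) (hS₀ : ∀ b ∉ S₀, b ∈ lamBondsSeq (maxDomT ν.M₁ Z) k 0)
    -- ONE forest and its axial slice per instance (dag-n12-w3's `N12ForestSlice.exists_forest_slice_Bj`): (F1), (F2), (TREE), (F3)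
    (path : Site (F.P Kt) 0 → List (LStep (F.P Kt) 0)) (S : Submodule ℂ (VecField (F.P Kt) 0 (EuclideanSpace ℂ (Fin 3))))
    (hF1 : ∀ x, ∀ s ∈ path x, ∃ x' x'' : Site (F.P Kt) 0, path x'' = path x' ++ [s] ∧
        (s.fwd = true → s.bond.src = x' ∧ s.bond.tgt = x'') ∧ (s.fwd = false → s.bond.src = x'' ∧ s.bond.tgt = x'))
    (hF2 : ∀ j, j ≤ k → ∀ c ∈ (𝔅 j), path (embIter j c.src) = [] ∧ path (embIter j c.tgt) = [])
    (hTREE : ∀ x : Site (F.P Kt) 0, x ∉ {z : Site (F.P Kt) 0 | ∃ j, j ≤ k ∧ ∃ c ∈ (𝔅 j), (z = embIter j c.src ∨ z = embIter j c.tgt)} →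
      ∃ (x' : Site (F.P Kt) 0) (s : LStep (F.P Kt) 0), path x = path x' ++ [s] ∧
        (s.fwd = true → s.bond.src = x' ∧ s.bond.tgt = x) ∧ (s.fwd = false → s.bond.src = x ∧ s.bond.tgt = x'))
    (hF3 : ∀ X : VecField (F.P Kt) 0 (EuclideanSpace ℂ (Fin 3)), X ∈ S ↔ ∀ x, ∀ s ∈ path x, X s.bond = 0) :
    -- THE CONSTANTS OF THE (β) ROW, announced before the tolerances and the base fields: the flat coercivity `c♭` of (P♭Q), the (L) constant `C` and radii `r_i`
    ∃ cflat C r : ℝ, 0 < cflat ∧ 0 ≤ C ∧ 0 < r ∧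
    -- THE WINDOW, THE DATUM's REGULARITY TOLERANCE, THE EXTENSION, THE COMPACT PARAMETER SET AND THE BOUND — ALL AFTER THE CONSTANTS
    ∀ (Λ : Set (Site (F.P Kt) k)) (lo hi : Fin (F.P Kt).d → ℤ) {δ : ℝ}, 0 < δ → 6 * ((((F.P Kt).d - 1 : ℕ)) : ℝ) * (F.P Kt).L ^ k * δ ≤ ρ'' →
    ∀ (ext : GaugeField (F.P Kt) k SU2 → GaugeField (F.P Kt) k SU2), (∀ W, ext W = extend Λ (shellGauge W lo hi) W) →
    ∀ {K : Set (GaugeField (F.P Kt) k SU2)}, IsCompact K → ∀ {𝓐₀ : ℝ}, 1 < 𝓐₀ →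
    -- THE CLASS TOLERANCE AND THE CLASS FACTS, AFTER THE CONSTANTS (εreg-uniform edition: `ν⟨εreg := εr⟩`, `M₁` unchanged)
    ∀ (εr : ℝ), 0 ≤ εr → 6 * ((((F.P Kt).d - 1 : ℕ)) : ℝ) * (F.P Kt).L * εr ≤ ρ'' →
    ∀ (reg' : Set (GaugeField (F.P Kt) 0 SU2)), IsClosed reg' → closure (Node00.regMSCoPOfRecord F 2 {ν with εreg := εr} Kt k (maxDomT ν.M₁ Z)) ⊆ reg' →
      ContinuousOn (fun (U : GaugeField (F.P Kt) 0 SU2) (i : Fin (constrCardB 𝔅 k)) =>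
        ((avgFamily (Node00.avOfRecord F 2 Kt) U ((constrEnumB 𝔅 k).symm i).1 ((constrEnumB 𝔅 k).symm i).2.1 : SU2) : Matrix (Fin 2) (Fin 2) ℂ)) reg' →
    ∀ {δc δT m : ℝ}, 0 ≤ δc → 0 ≤ δT → δT ≤ r →
      64 * (((F.P Kt).d : ℝ) - 1) * δc + m + (constrCardB 𝔅 k : ℝ) * C ^ 2 * δT ^ 2 < cflat →
    (∀ Vk ∈ K, ∃ (U₀ : GaugeField (F.P Kt) 0 SU2) (a : S → ℂ) (Φ₀ : S → Fin (constrCardB 𝔅 k) → EuclideanSpace ℂ (Fin 3)),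
      IsMinimizerB (Node00.avOfRecord F 2 Kt) (Node00.regMSCoPOfRecord F 2 {ν with εreg := εr} Kt k (maxDomT ν.M₁ Z)) 𝔅
        (avgFamily (Node00.avOfRecord F 2 Kt) (qsstarGIter0 k (ext Vk))) U₀ ∧
      PlaqSmallOn (plaqsInside (pts k Z)) δ (ext Vk) ∧
      (∀ X : S, a X = ∑ p : Plaq (F.P Kt) 0, (1 - (expMulC (X : VecField (F.P Kt) 0 (EuclideanSpace ℂ (Fin 3))) (coeField U₀) ⟨p.src, p.μ⟩ *
        expMulC (X : VecField (F.P Kt) 0 (EuclideanSpace ℂ (Fin 3))) (coeField U₀) ⟨p.src.shift p.μ, p.ν⟩ *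
        Matrix.adjugate (expMulC (X : VecField (F.P Kt) 0 (EuclideanSpace ℂ (Fin 3))) (coeField U₀) ⟨p.src.shift p.ν, p.μ⟩) *
        Matrix.adjugate (expMulC (X : VecField (F.P Kt) 0 (EuclideanSpace ℂ (Fin 3))) (coeField U₀) ⟨p.src, p.ν⟩)).trace / 2)) ∧
      (∀ (X : S) i, Φ₀ X i = logCoordC (star ((avgFamily (Node00.avOfRecord F 2 Kt) (qsstarGIter0 k (ext Vk))
        ((constrEnumB 𝔅 k).symm i).1 ((constrEnumB 𝔅 k).symm i).2.1 : SU2) : Matrix (Fin 2) (Fin 2) ℂ) *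
        iterMh ((constrEnumB 𝔅 k).symm i).1 (expMulC (X : VecField (F.P Kt) 0 (EuclideanSpace ℂ (Fin 3))) (coeField U₀)) ((constrEnumB 𝔅 k).symm i).2.1)) ∧
      -- (45), VELOCITY currency — the capstone's row verbatim
      (∀ τ : Fin (constrCardB 𝔅 k) → EuclideanSpace ℝ (Fin 3), ∃ p : VecField (F.P Kt) 0 E3, cplxVec p ∈ S ∧
        ∀ i : Fin (constrCardB 𝔅 k), HasDerivAt (fun s : ℝ => ((avgFamily (Node00.avOfRecord F 2 Kt) (expMul su2Chart (s • p) U₀)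
          ((constrEnumB 𝔅 k).symm i).1 ((constrEnumB 𝔅 k).symm i).2.1 : SU2) : Matrix (Fin 2) (Fin 2) ℂ))
          (((avgFamily (Node00.avOfRecord F 2 Kt) (qsstarGIter0 k (ext Vk)) ((constrEnumB 𝔅 k).symm i).1
            ((constrEnumB 𝔅 k).symm i).2.1 : SU2) : Matrix (Fin 2) (Fin 2) ℂ) * ∑ b : Fin 3, ((τ i b : ℝ) : ℂ) • genE b) 0) ∧
      -- (δ) DISPLAYED (GAUGE letter, the direct road's (N)-package clause): `U₀` bondwise `δc`-flat on the plaquettes meeting the displayed support set `S₀`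
      (∀ q : Plaq (F.P Kt) 0, ((⟨q.src, q.μ⟩ : PBond (F.P Kt) 0) ∈ S₀ ∨
          (⟨q.src.shift q.μ, q.ν⟩ : PBond (F.P Kt) 0) ∈ S₀ ∨
          (⟨q.src.shift q.ν, q.μ⟩ : PBond (F.P Kt) 0) ∈ S₀ ∨
          (⟨q.src, q.ν⟩ : PBond (F.P Kt) 0) ∈ S₀) →
        ‖((U₀ ⟨q.src, q.μ⟩ : SU2) : Matrix (Fin 2) (Fin 2) ℂ) - 1‖ ≤ δc ∧ ‖((U₀ ⟨q.src.shift q.μ, q.ν⟩ : SU2) : Matrix (Fin 2) (Fin 2) ℂ) - 1‖ ≤ δc ∧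
          ‖((U₀ ⟨q.src.shift q.ν, q.μ⟩ : SU2) : Matrix (Fin 2) (Fin 2) ℂ) - 1‖ ≤ δc ∧ ‖((U₀ ⟨q.src, q.ν⟩ : SU2) : Matrix (Fin 2) (Fin 2) ℂ) - 1‖ ≤ δc) ∧
      -- (δ_T) DISPLAYED (GAUGE letter): `U₀` bondwise `δT`-flat on the level-0 bonds of the tower regions of the POSITIVE-LEVEL constrained bonds of `𝐁_k(Z)`
      (∀ i : Fin (constrCardB 𝔅 k), 0 < (((constrEnumB 𝔅 k).symm i).1 : ℕ) →
        ∀ b : PBond (F.P Kt) 0, b ∈ B10Eq42TorusConstraint.bondsIn 0 (B14.Eq22Determines.blockIter (((constrEnumB 𝔅 k).symm i).1 : ℕ) ⁻¹'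
          ({((constrEnumB 𝔅 k).symm i).2.1.src, ((constrEnumB 𝔅 k).symm i).2.1.tgt} : Set (Site (F.P Kt) ((constrEnumB 𝔅 k).symm i).1))) →
          ‖((U₀ b : SU2) : Matrix (Fin 2) (Fin 2) ℂ) - 1‖ ≤ δT) ∧
      -- (M) DISPLAYED: the MULTIPLIER letter, for every multiplier of the base state
      (∀ ℓ₀ : (Fin (constrCardB 𝔅 k) → EuclideanSpace ℂ (Fin 3)) →L[ℂ] ℂ, fderiv ℂ a 0 = ℓ₀.comp (fderiv ℂ Φ₀ 0) →
        ∀ (p : VecField (F.P Kt) 0 E3) (hp : cplxVec p ∈ S), fderiv ℂ Φ₀ 0 ⟨cplxVec p, hp⟩ = 0 →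
          (ℓ₀ (fderiv ℂ (fderiv ℂ Φ₀) 0 ⟨cplxVec p, hp⟩ ⟨cplxVec p, hp⟩)).re ≤ m * ∑ b : PBond (F.P Kt) 0, ‖p b‖ ^ 2) ∧
      -- (T1@q₀) — the capstone's row verbatim
      (∀ U ∈ reg', AgreeOnB 𝔅 (avgFamily (Node00.avOfRecord F 2 Kt) U) (avgFamily (Node00.avOfRecord F 2 Kt) (qsstarGIter0 k (ext Vk))) →
        wilsonAction4 U ≤ wilsonAction4 U₀ →
          ∃ u : GaugeTransf (F.P Kt) 0 SU2, (∀ j, j ≤ k → ∀ b ∈ (𝔅 j), toMS u j b.src = toMS u j b.tgt ∧ ∀ g : SU2, toMS u j b.src * g = g * toMS u j b.src) ∧ gaugeAct u U = U₀)) →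
    ∃ R : ℝ, 0 < R ∧ ∀ Vk ∈ K,
      ∃ Ũ : VecField (F.P Kt) k (EuclideanSpace ℂ (Fin 3)) × VecField (F.P Kt) k (EuclideanSpace ℂ (Fin 3)) → PBond (F.P Kt) 0 → Matrix (Fin 2) (Fin 2) ℂ,
        (∀ b i j, DifferentiableOn ℂ (fun z => Ũ z b i j) (ball 0 R)) ∧
        (∀ z ∈ ball (0 : VecField (F.P Kt) k (EuclideanSpace ℂ (Fin 3)) × VecField (F.P Kt) k (EuclideanSpace ℂ (Fin 3))) R, ∀ b i j, ‖Ũ z b i j‖ ≤ 𝓐₀) ∧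
        ∀ p B' : VecField (F.P Kt) k E3, ‖p‖ < R → ‖B'‖ < R → ∃ U' : GaugeField (F.P Kt) 0 SU2,
          (∀ b, Ũ (cplxVec p, cplxVec B') b = ((U' b : SU2) : Matrix (Fin 2) (Fin 2) ℂ)) ∧
            IsMinimizerB (Node00.avOfRecord F 2 Kt) (Node00.regMSCoPOfRecord F 2 {ν with εreg := εr} Kt k (maxDomT ν.M₁ Z)) 𝔅
              (avgFamily (Node00.avOfRecord F 2 Kt) (qsstarGIter0 k (expMul su2Chart B' (ext (expMul su2Chart p Vk))))) U' := by
  subst h𝔅Z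
  have hk : k ≤ (F.P Kt).m + (F.P Kt).K := Nat.le_of_succ_le hkK
  have hk1 : 1 ≤ k := hk0
  have hM : 1 ≤ ν.M₁ := le_trans (le_trans (F.P Kt).L_pos (by omega)) hM4
  -- the constants: `c♭` of (P♭Q) (compactness, flat (β)♭), `C`, `r` of (L) (tower calculus) — none of them reads `εreg`
  obtain ⟨cflat, hcflat, hPQ⟩ := exists_flatAveragedCoercive_forest_lamBondsSeq_su2Chart (F := F) (K := Kt) (Z := Z) hk hk1 hM hdiv hTREE
  obtain ⟨C, r, hC, hr, hL⟩ := exists_flatAverageBound_of_guardOn_towerNearFlat (lamBondsSeq (maxDomT ν.M₁ Z) k) k hk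
  refine ⟨cflat, C, r, hcflat, hC, hr, fun Λ lo hi {δ} hδ hδρ ext hext {K} hK {𝓐₀} h𝓐₀ εr hε hερ reg' hreg' hcl hDreg' {δc δT m} hδc0 hδT0 hδTr hnum hbase => ?_⟩
  -- p712371 at `ν⟨εreg := εr⟩` (its `M₁` is `ν.M₁` by `rfl`)
  refine hMin_atRecord_of_node00Letters_thm1AtBase_central_ofClass_nearFlat {ν with εreg := εr} Kt hd Z Λ lo hi (lamBondsSeq (maxDomT ν.M₁ Z) k) rfl hkK hM4 hdiv hZblk hε hsbU hερ hδ hδρ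
    ext hext hK h𝓐₀ reg' hreg' hcl hDreg' S₀ hS₀ (δc := δc) (cP := cflat - (constrCardB (lamBondsSeq (maxDomT ν.M₁ Z) k) k : ℝ) * C ^ 2 * δT ^ 2) (m := m) hδc0 (by linarith)
    fun Vk hVk => ?_
  obtain ⟨U₀, a, Φ₀, hmin, hreg, ha, hΦ₀, hH, hNF, hflatT, hMul, hT1⟩ := hbase Vk hVk
  have hgU := guardOn_towerRegion_lamBondsSeq_of_mem_class {ν with εreg := εr} Kt Z hkK hM4 hdiv hε hsbU hερ hmin.1
  have hslice : ∀ p : VecField (F.P Kt) 0 E3, cplxVec p ∈ S → ∀ x, ∀ s ∈ path x, p s.bond = 0 := fun p hp x s hs => by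
    have h0 : cplxVec p s.bond = 0 := (hF3 (cplxVec p)).1 hp x s hs
    have hn : ‖p s.bond‖ = 0 := by rw [← norm_cplxVec_apply, h0, norm_zero]
    exact norm_eq_zero.1 hn
  have hP : ∀ (p : VecField (F.P Kt) 0 E3) (hp : cplxVec p ∈ S), fderiv ℂ Φ₀ 0 ⟨cplxVec p, hp⟩ = 0 →
      (cflat - (constrCardB (lamBondsSeq (maxDomT ν.M₁ Z) k) k : ℝ) * C ^ 2 * δT ^ 2) * ∑ b : PBond (F.P Kt) 0, ‖p b‖ ^ 2 ≤
        deriv (deriv fun s : ℝ => wilsonAction4 (expMul su2Chart (s • p) (1 : GaugeField (F.P Kt) 0 SU2))) 0 :=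
    flatCoercive_of_flatAveragedCoercive_of_flatAverageBound_sliceDatum (lamBondsSeq (maxDomT ν.M₁ Z) k) k S Φ₀ (fun p hp => hPQ p (hslice p hp))
      (fun p hp hker => hL _ U₀ hgU hmin.2.1 S Φ₀ hΦ₀ hδT0 hδTr hflatT p hp hker)
  exact ⟨U₀, S, path, a, Φ₀, hmin, hreg, hF1, hF2, hF3, ha, hΦ₀, hH, hNF, hP, hMul, hT1⟩

end

section
variable {F : T4Family} {k : ℕ}

/-- ★★★ **V3u — ONE GAUGE ROW, CONSTANTS BEFORE THE CLASS TOLERANCE.**  As `…N12MinimiserFamilyOfClassGaugeRow` (p721526) VERBATIM with the same binder re-ordering; the tower-flatness row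
(δ_T) is derived per base field from (δ) and the constraint (`B15Prop1TowerFlatOfNearFlatB.towerNearFlat_of_nearFlat_of_agreeOn_constr`).
[cite: Balaban1989LargeFieldII, (1.7)–(1.9) p.358, (1.12) p.359; Balaban1989LargeFieldI, (1.74) p.192, Prop. 1 p.194; Balaban1985Variational, Thm 1 p.279, (82)–(83) p.290; Balaban1988Convergent, (1.3) p.246, (2.2) p.255, (2.10)–(2.13) pp.256–257] -/
theorem hMin_atRecord_of_node00Letters_thm1AtBase_central_ofClass_gaugeRow_uniform (ν : Node00.Stage7Numerics) (Kt : ℕ) (hd : 2 ≤ (F.P Kt).d) (Z : Set (Site (F.P Kt) 0)) (𝔅 : BDetSet (F.P Kt)) (h𝔅Z : 𝔅 = lamBondsSeq (maxDomT ν.M₁ Z) k) (hkK : k + 1 ≤ (F.P Kt).m + (F.P Kt).K)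
    (hM4 : 4 * (F.P Kt).L ≤ ν.M₁) (hdiv : side (F.P Kt).L ν.M₁ k ∣ (F.P Kt).sitesPerDir 0) (hZblk : B14.Eq22Determines.IsBlockUnion k Z)
    {ρ'' : ℝ} (hsbU : ∀ W : GaugeField (F.P Kt) 0 SU2, ‖coeField W - 1‖ ≤ ρ'' → SmallBelow (Node00.avOfRecord F 2 Kt) k W)
    -- ONCE per height: the numerics of the (β) split — the near-flat tolerance, the flat coercivity constant, the multiplier constant
    (hk0 : 0 < k) (S₀ : Set (PBond (F.P Kt) 0)) (hS₀ : ∀ b ∉ S₀, b ∈ lamBondsSeq (maxDomT ν.M₁ Z) k 0)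
    (hS₀1 : {b : PBond (F.P Kt) 0 | b.src ∈ maxDomT ν.M₁ Z 1} ⊆ S₀)
    -- ONE forest and its axial slice per instance (dag-n12-w3's `N12ForestSlice.exists_forest_slice_Bj`): (F1), (F2), (TREE), (F3)
    (path : Site (F.P Kt) 0 → List (LStep (F.P Kt) 0)) (S : Submodule ℂ (VecField (F.P Kt) 0 (EuclideanSpace ℂ (Fin 3))))
    (hF1 : ∀ x, ∀ s ∈ path x, ∃ x' x'' : Site (F.P Kt) 0, path x'' = path x' ++ [s] ∧
        (s.fwd = true → s.bond.src = x' ∧ s.bond.tgt = x'') ∧ (s.fwd = false → s.bond.src = x'' ∧ s.bond.tgt = x'))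
    (hF2 : ∀ j, j ≤ k → ∀ c ∈ (𝔅 j), path (embIter j c.src) = [] ∧ path (embIter j c.tgt) = [])
    (hTREE : ∀ x : Site (F.P Kt) 0, x ∉ {z : Site (F.P Kt) 0 | ∃ j, j ≤ k ∧ ∃ c ∈ (𝔅 j), (z = embIter j c.src ∨ z = embIter j c.tgt)} →
      ∃ (x' : Site (F.P Kt) 0) (s : LStep (F.P Kt) 0), path x = path x' ++ [s] ∧
        (s.fwd = true → s.bond.src = x' ∧ s.bond.tgt = x) ∧ (s.fwd = false → s.bond.src = x ∧ s.bond.tgt = x'))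
    (hF3 : ∀ X : VecField (F.P Kt) 0 (EuclideanSpace ℂ (Fin 3)), X ∈ S ↔ ∀ x, ∀ s ∈ path x, X s.bond = 0) :
    -- THE CONSTANTS OF THE (β) ROW, announced before the tolerance and the base fields: the flat coercivity `c♭` of (P♭Q), the (L) constant `C` and radius `r`
    ∃ cflat C r : ℝ, 0 < cflat ∧ 0 ≤ C ∧ 0 < r ∧
    -- THE WINDOW, THE DATUM's REGULARITY TOLERANCE, THE EXTENSION, THE COMPACT PARAMETER SET AND THE BOUND — ALL AFTER THE CONSTANTS
    ∀ (Λ : Set (Site (F.P Kt) k)) (lo hi : Fin (F.P Kt).d → ℤ) {δ : ℝ}, 0 < δ → 6 * ((((F.P Kt).d - 1 : ℕ)) : ℝ) * (F.P Kt).L ^ k * δ ≤ ρ'' →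
    ∀ (ext : GaugeField (F.P Kt) k SU2 → GaugeField (F.P Kt) k SU2), (∀ W, ext W = extend Λ (shellGauge W lo hi) W) →
    ∀ {K : Set (GaugeField (F.P Kt) k SU2)}, IsCompact K → ∀ {𝓐₀ : ℝ}, 1 < 𝓐₀ →
    -- THE CLASS TOLERANCE AND THE CLASS FACTS, AFTER THE CONSTANTS (εreg-uniform edition: `ν⟨εreg := εr⟩`, `M₁` unchanged)
    ∀ (εr : ℝ), 0 ≤ εr → 6 * ((((F.P Kt).d - 1 : ℕ)) : ℝ) * (F.P Kt).L * εr ≤ ρ'' →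
    ∀ (reg' : Set (GaugeField (F.P Kt) 0 SU2)), IsClosed reg' → closure (Node00.regMSCoPOfRecord F 2 {ν with εreg := εr} Kt k (maxDomT ν.M₁ Z)) ⊆ reg' →
      ContinuousOn (fun (U : GaugeField (F.P Kt) 0 SU2) (i : Fin (constrCardB 𝔅 k)) =>
        ((avgFamily (Node00.avOfRecord F 2 Kt) U ((constrEnumB 𝔅 k).symm i).1 ((constrEnumB 𝔅 k).symm i).2.1 : SU2) : Matrix (Fin 2) (Fin 2) ℂ)) reg' →
    ∀ {δc m : ℝ}, 0 ≤ δc → δc ≤ r →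
      64 * (((F.P Kt).d : ℝ) - 1) * δc + m + (constrCardB 𝔅 k : ℝ) * C ^ 2 * δc ^ 2 < cflat →
    (∀ Vk ∈ K, ∃ (U₀ : GaugeField (F.P Kt) 0 SU2) (a : S → ℂ) (Φ₀ : S → Fin (constrCardB 𝔅 k) → EuclideanSpace ℂ (Fin 3)),
      IsMinimizerB (Node00.avOfRecord F 2 Kt) (Node00.regMSCoPOfRecord F 2 {ν with εreg := εr} Kt k (maxDomT ν.M₁ Z)) 𝔅
        (avgFamily (Node00.avOfRecord F 2 Kt) (qsstarGIter0 k (ext Vk))) U₀ ∧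
      PlaqSmallOn (plaqsInside (pts k Z)) δ (ext Vk) ∧
      (∀ X : S, a X = ∑ p : Plaq (F.P Kt) 0, (1 - (expMulC (X : VecField (F.P Kt) 0 (EuclideanSpace ℂ (Fin 3))) (coeField U₀) ⟨p.src, p.μ⟩ *
        expMulC (X : VecField (F.P Kt) 0 (EuclideanSpace ℂ (Fin 3))) (coeField U₀) ⟨p.src.shift p.μ, p.ν⟩ *
        Matrix.adjugate (expMulC (X : VecField (F.P Kt) 0 (EuclideanSpace ℂ (Fin 3))) (coeField U₀) ⟨p.src.shift p.ν, p.μ⟩) *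
        Matrix.adjugate (expMulC (X : VecField (F.P Kt) 0 (EuclideanSpace ℂ (Fin 3))) (coeField U₀) ⟨p.src, p.ν⟩)).trace / 2)) ∧
      (∀ (X : S) i, Φ₀ X i = logCoordC (star ((avgFamily (Node00.avOfRecord F 2 Kt) (qsstarGIter0 k (ext Vk))
        ((constrEnumB 𝔅 k).symm i).1 ((constrEnumB 𝔅 k).symm i).2.1 : SU2) : Matrix (Fin 2) (Fin 2) ℂ) *
        iterMh ((constrEnumB 𝔅 k).symm i).1 (expMulC (X : VecField (F.P Kt) 0 (EuclideanSpace ℂ (Fin 3))) (coeField U₀)) ((constrEnumB 𝔅 k).symm i).2.1)) ∧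
      -- (45), VELOCITY currency — the capstone's row verbatim
      (∀ τ : Fin (constrCardB 𝔅 k) → EuclideanSpace ℝ (Fin 3), ∃ p : VecField (F.P Kt) 0 E3, cplxVec p ∈ S ∧
        ∀ i : Fin (constrCardB 𝔅 k), HasDerivAt (fun s : ℝ => ((avgFamily (Node00.avOfRecord F 2 Kt) (expMul su2Chart (s • p) U₀)
          ((constrEnumB 𝔅 k).symm i).1 ((constrEnumB 𝔅 k).symm i).2.1 : SU2) : Matrix (Fin 2) (Fin 2) ℂ))
          (((avgFamily (Node00.avOfRecord F 2 Kt) (qsstarGIter0 k (ext Vk)) ((constrEnumB 𝔅 k).symm i).1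
            ((constrEnumB 𝔅 k).symm i).2.1 : SU2) : Matrix (Fin 2) (Fin 2) ℂ) * ∑ b : Fin 3, ((τ i b : ℝ) : ℂ) • genE b) 0) ∧
      -- (δ) DISPLAYED — THE ONE GAUGE letter (the direct road's (N)-package clause): `U₀` bondwise `δc`-flat on the plaquettes meeting a bond sourced in `Ω₁(Z)`; the tower-flatness row (δ_T) of p717767 FOLLOWS (`B15Prop1TowerFlatOfNearFlat`)
      (∀ q : Plaq (F.P Kt) 0, ((⟨q.src, q.μ⟩ : PBond (F.P Kt) 0) ∈ S₀ ∨
          (⟨q.src.shift q.μ, q.ν⟩ : PBond (F.P Kt) 0) ∈ S₀ ∨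
          (⟨q.src.shift q.ν, q.μ⟩ : PBond (F.P Kt) 0) ∈ S₀ ∨
          (⟨q.src, q.ν⟩ : PBond (F.P Kt) 0) ∈ S₀) →
        ‖((U₀ ⟨q.src, q.μ⟩ : SU2) : Matrix (Fin 2) (Fin 2) ℂ) - 1‖ ≤ δc ∧ ‖((U₀ ⟨q.src.shift q.μ, q.ν⟩ : SU2) : Matrix (Fin 2) (Fin 2) ℂ) - 1‖ ≤ δc ∧
          ‖((U₀ ⟨q.src.shift q.ν, q.μ⟩ : SU2) : Matrix (Fin 2) (Fin 2) ℂ) - 1‖ ≤ δc ∧ ‖((U₀ ⟨q.src, q.ν⟩ : SU2) : Matrix (Fin 2) (Fin 2) ℂ) - 1‖ ≤ δc) ∧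
      -- (M) DISPLAYED: the MULTIPLIER letter, for every multiplier of the base state
      (∀ ℓ₀ : (Fin (constrCardB 𝔅 k) → EuclideanSpace ℂ (Fin 3)) →L[ℂ] ℂ, fderiv ℂ a 0 = ℓ₀.comp (fderiv ℂ Φ₀ 0) →
        ∀ (p : VecField (F.P Kt) 0 E3) (hp : cplxVec p ∈ S), fderiv ℂ Φ₀ 0 ⟨cplxVec p, hp⟩ = 0 →
          (ℓ₀ (fderiv ℂ (fderiv ℂ Φ₀) 0 ⟨cplxVec p, hp⟩ ⟨cplxVec p, hp⟩)).re ≤ m * ∑ b : PBond (F.P Kt) 0, ‖p b‖ ^ 2) ∧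
      -- (T1@q₀) — the capstone's row verbatim
      (∀ U ∈ reg', AgreeOnB 𝔅 (avgFamily (Node00.avOfRecord F 2 Kt) U) (avgFamily (Node00.avOfRecord F 2 Kt) (qsstarGIter0 k (ext Vk))) →
        wilsonAction4 U ≤ wilsonAction4 U₀ →
          ∃ u : GaugeTransf (F.P Kt) 0 SU2, (∀ j, j ≤ k → ∀ b ∈ (𝔅 j), toMS u j b.src = toMS u j b.tgt ∧ ∀ g : SU2, toMS u j b.src * g = g * toMS u j b.src) ∧ gaugeAct u U = U₀)) →
    ∃ R : ℝ, 0 < R ∧ ∀ Vk ∈ K,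
      ∃ Ũ : VecField (F.P Kt) k (EuclideanSpace ℂ (Fin 3)) × VecField (F.P Kt) k (EuclideanSpace ℂ (Fin 3)) → PBond (F.P Kt) 0 → Matrix (Fin 2) (Fin 2) ℂ,
        (∀ b i j, DifferentiableOn ℂ (fun z => Ũ z b i j) (ball 0 R)) ∧
        (∀ z ∈ ball (0 : VecField (F.P Kt) k (EuclideanSpace ℂ (Fin 3)) × VecField (F.P Kt) k (EuclideanSpace ℂ (Fin 3))) R, ∀ b i j, ‖Ũ z b i j‖ ≤ 𝓐₀) ∧
        ∀ p B' : VecField (F.P Kt) k E3, ‖p‖ < R → ‖B'‖ < R → ∃ U' : GaugeField (F.P Kt) 0 SU2,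
          (∀ b, Ũ (cplxVec p, cplxVec B') b = ((U' b : SU2) : Matrix (Fin 2) (Fin 2) ℂ)) ∧
            IsMinimizerB (Node00.avOfRecord F 2 Kt) (Node00.regMSCoPOfRecord F 2 {ν with εreg := εr} Kt k (maxDomT ν.M₁ Z)) 𝔅
              (avgFamily (Node00.avOfRecord F 2 Kt) (qsstarGIter0 k (expMul su2Chart B' (ext (expMul su2Chart p Vk))))) U' := by
  obtain ⟨cflat, C, r, hcflat, hC, hr, hV2⟩ := hMin_atRecord_of_node00Letters_thm1AtBase_central_ofClass_gaugeRows_uniform ν Kt hd Z 𝔅 h𝔅Z hkK hM4 hdiv hZblk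
    hsbU hk0 S₀ hS₀ path S hF1 hF2 hTREE hF3
  refine ⟨cflat, C, r, hcflat, hC, hr, fun Λ lo hi {δ} hδ hδρ ext hext {K} hK {𝓐₀} h𝓐₀ εr hε hερ reg' hreg' hcl hDreg' {δc m} hδc0 hδcr hnum hbase => ?_⟩
  refine hV2 Λ lo hi hδ hδρ ext hext hK h𝓐₀ εr hε hερ reg' hreg' hcl hDreg' (δc := δc) (δT := δc) (m := m) hδc0 hδc0 hδcr hnum fun Vk hVk => ?_
  obtain ⟨U₀, a, Φ₀, hmin, hreg, ha, hΦ₀, hH, hNF, hMul, hT1⟩ := hbase Vk hVk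
  subst h𝔅Z
  have hk : k ≤ (F.P Kt).m + (F.P Kt).K := Nat.le_of_succ_le hkK
  have hM : 1 ≤ ν.M₁ := le_trans (le_trans (F.P Kt).L_pos (by omega)) hM4
  -- (δ_T) from (δ) through dag-n12-c's bond-datum tower lemma: print's datum is a sub-datum of reading (b) pinned at level 0 off `Ω₁(Z)`; (δ) on `S₀ ⊇ {b | b.src ∈ Ω₁(Z)}`
  have hNF' := fun q (hq : (⟨q.src, q.μ⟩ : PBond (F.P Kt) 0) ∈ {b : PBond (F.P Kt) 0 | b.src ∈ maxDomT ν.M₁ Z 1} ∨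
      (⟨q.src.shift q.μ, q.ν⟩ : PBond (F.P Kt) 0) ∈ {b : PBond (F.P Kt) 0 | b.src ∈ maxDomT ν.M₁ Z 1} ∨
      (⟨q.src.shift q.ν, q.μ⟩ : PBond (F.P Kt) 0) ∈ {b : PBond (F.P Kt) 0 | b.src ∈ maxDomT ν.M₁ Z 1} ∨
      (⟨q.src, q.ν⟩ : PBond (F.P Kt) 0) ∈ {b : PBond (F.P Kt) 0 | b.src ∈ maxDomT ν.M₁ Z 1}) =>
    hNF q (hq.imp (fun h => hS₀1 h) fun h => h.imp (fun h => hS₀1 h) fun h => h.imp (fun h => hS₀1 h) fun h => hS₀1 h)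
  have hflatT := towerNearFlat_of_nearFlat_of_agreeOn_constr (N := 2) hM hd Z hk hdiv (lamBondsSeq (maxDomT ν.M₁ Z) k)
    (lamBondsSeq_subset_bondsOf_genSet (maxDomT ν.M₁ Z) k) (mem_lamDatumP_maxDomT_zero_of_not_mem₂ hM hk0 hk hdiv)
    (Node00.avOfRecord F 2 Kt) (ext Vk) hmin.2.1 hδc0 hNF'
  exact ⟨U₀, a, Φ₀, hmin, hreg, ha, hΦ₀, hH, hNF, hflatT, hMul, hT1⟩

end

end Summit.QuantumFields.YangMills.BalabanUVNodes.N12MinimiserFamilyOfClassGaugeRowUniformB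

end
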